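import Mathlib
import Summits.Parity.GeneralizedHardyLittlewood.Theorems.FordMaynardSieveConst01651SieveConst01651MainCaseReindex
import Summits.Parity.GeneralizedHardyLittlewood.Theorems.FordMaynardSieveConst01651SieveConst01651MonotoneThresholds
import Summits.Parity.GeneralizedHardyLittlewood.Theorems.FordMaynardSieveConst01651SieveConst01651MainCaseMonotone
import Summits.Parity.GeneralizedHardyLittlewood.Theorems.FordMaynardSieveConst01651SieveConst01651TypeIIBilin
import Summits.Parity.GeneralizedHardyLittlewood.Theorems.FordMaynardSieveConst01651SieveConst01651PolytopeConditions

/-!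
# Route `FordMaynardSieveConst01651`, target `SieveConst01651` (stmt-Parity-19185), line `sieve_decomposition`:
# helpers towards `stub_typeIIRegion` — the separated KERNEL of one polytope piece of the main case

Ford–Maynard, arXiv:2407.14368v1, Proposition 7.19 / proof of Proposition 7.22, at `(γ, θ, ν) = (1/2, 0, ν)`:
`|∑_{n ∈ ℛ} w(n) H(n)| ≤ K x/(log x)^A` for every `w` with (I) at level `x^{1/2}` and (II) on `(1, x^ν]` (exponent
`B ≥ B₀(A, g, ν)`).  PROOF ROUTE (integer thresholds, no Perron shells): the boundary part of `ℛ` is `≪ x/(log x)^B` by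
(I) (`…RsetSplit.Rset_edge_abs_sum_le`); the main part `n₁ > 1` is the bilinear form of
`…MainCaseReindex.sum_main_eq_sum_bilinear` in (prime `d = P⁺(u)`) × (`z = (e, m, u')`); `g(𝐯(m; de))` is expanded
over the polytope pieces of `g` (`IsPiecewiseConstOnCone`), each face being a condition `∑ aᵢ log pᵢ < b log(de)`;
every entangling condition is monotone in `d` (`…MainCaseMonotone`), hence an integer threshold separable at cost
`3(1 + log(2N+4))` (`…MonotoneThresholds`), and (II) in `BilinBoundedBy` form (`…TypeIIBilin`) with the long-side fibre
lift finishes.  No lower bound on `w` and no use of the growth condition (w) are needed at `θ = 0`.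

* `apply_pvec_expand` — `g(𝐯(m; n))` as a sum over dimensions `k ≤ K₀` and pieces `j`;
* `indicator_mem_pieces_eq_prod` — a piece indicator as a product of face-threshold indicators in log form;
* `bilin_main_kernel` — the `BilinBoundedBy` bound for the fully entangled kernel of one piece;
* `length_primeFactorsList_le_floor` — `Ω(m) ≤ ⌊1/ν⌋` for the rough divisor;
* `main_kernel_eq` — the separated kernel equals the main-case summand of one piece, pointwise.

Def-free. Nothing here proves anything about the Parity summit; helpers for the Type-II region stub of one leaf.
-/

open Finset Literature.NumberTheory.Sieve Literature.NumberTheory.Sieve.FordMaynard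
open Literature.NumberTheory.Sieve.FriedlanderIwaniecPrimes

namespace Summit.Parity.GeneralizedHardyLittlewood.FordMaynardSieveConst01651SieveConst01651

open scoped Classical

/-- **`g(𝐯(m; n))` expanded over the pieces of `g`.** If `g_k(v) = ∑_j c_{k,j} 𝟙[v ∈ P_{k,j}]` on monotone `v`
(all `k`) and `Ω(m) ≤ K₀`, then `g(𝐯(m; n)) = ∑_{k ≤ K₀} ∑_j 𝟙[Ω(m) = k] c_{k,j} 𝟙[𝐯_k(m; n) ∈ P_{k,j}]` with the
total `k`-vector `𝐯_k(m; n)ᵢ = log(pᵢ)/log n` (`pᵢ` the `i`-th prime of `m`, `0` beyond `Ω(m)`).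
[cite: FordMaynard2024PrimeSieves, Definition 7.2 / proof of Proposition 7.22 (polytope conditions)] -/
theorem apply_pvec_expand (g : VecFn) (nP : ℕ → ℕ) (P : (k : ℕ) → Fin (nP k) → Set (Fin k → ℝ))
    (c : (k : ℕ) → Fin (nP k) → ℝ)
    (hgP : ∀ (k : ℕ) (v : Fin k → ℝ), Monotone v → g k v = ∑ j, if v ∈ P k j then c k j else 0)
    {K₀ n m : ℕ} (hK : m.primeFactorsList.length ≤ K₀) :
    g _ (pvec n m) = ∑ k ∈ Finset.range (K₀ + 1), ∑ j : Fin (nP k),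
      if m.primeFactorsList.length = k then
        (if (fun i : Fin k => Real.log (m.primeFactorsList.getD i 0) / Real.log n) ∈ P k j then c k j else 0)
      else 0 := by
  classical
  have hstep : ∀ k : ℕ, (∑ j : Fin (nP k),
      if m.primeFactorsList.length = k then
        (if (fun i : Fin k => Real.log (m.primeFactorsList.getD i 0) / Real.log n) ∈ P k j then c k j else 0)
      else 0) = if m.primeFactorsList.length = k then
        g k (fun i : Fin k => Real.log (m.primeFactorsList.getD i 0) / Real.log n) else 0 := by
    intro k
    by_cases h : m.primeFactorsList.length = k
    · subst h
      have hv : (fun i : Fin m.primeFactorsList.length =>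
          Real.log (m.primeFactorsList.getD i 0) / Real.log n) = pvec n m := by
        funext i
        simp only [pvec, List.get_eq_getElem, List.getD_eq_getElem _ _ i.2]
      simp only [if_true, hv]
      rw [hgP _ _ (pvec_mono n m)]
    · simp only [if_neg h, Finset.sum_const_zero]
  simp_rw [hstep]
  rw [Finset.sum_ite_eq]
  rw [if_pos (Finset.mem_range.mpr (Nat.lt_succ_of_le hK))]
  congr 1
  funext i
  simp only [pvec, List.get_eq_getElem, List.getD_eq_getElem _ _ i.2]

/-- **A piece indicator as a product of face indicators in log form.** If `P = {v | (∀ c ∈ S, ∑ cᵢ vᵢ < c₀) ∧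
(∀ c ∈ T, ∑ cᵢ vᵢ ≤ c₀)}` and `log n > 0`, then for `vᵢ = yᵢ / log n`:
`𝟙[v ∈ P] = ∏_{c ∈ S} 𝟙[∑ cᵢ yᵢ < c₀ log n] · ∏_{c ∈ T} 𝟙[∑ cᵢ yᵢ ≤ c₀ log n]` (complex `0/1` indicators).
[cite: FordMaynard2024PrimeSieves, proof of Proposition 7.22 (polytope conditions as linear inequalities)] -/
theorem indicator_mem_pieces_eq_prod {k : ℕ} {Pset : Set (Fin k → ℝ)} {S T : Finset ((Fin k → ℝ) × ℝ)}
    (hST : Pset = {v | (∀ cf ∈ S, ∑ i, cf.1 i * v i < cf.2) ∧ ∀ cf ∈ T, ∑ i, cf.1 i * v i ≤ cf.2})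
    (y : Fin k → ℝ) {L : ℝ} (hL : 0 < L) :
    (if (fun i => y i / L) ∈ Pset then (1 : ℂ) else 0) =
      (∏ cf ∈ S, if ∑ i, cf.1 i * y i < cf.2 * L then (1 : ℂ) else 0) *
        ∏ cf ∈ T, if ∑ i, cf.1 i * y i ≤ cf.2 * L then (1 : ℂ) else 0 := by
  classical
  rw [← ite_forall_finset_eq_prod, ← ite_forall_finset_eq_prod, ← ite_and_eq_mul]
  congr 1
  rw [hST, Set.mem_setOf_eq]
  simp only [sum_mul_div_lt_iff _ _ hL, sum_mul_div_le_iff _ _ hL]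

/-- **The `BilinBoundedBy` bound for the fully entangled kernel of one piece** (`θ = 0`).  From (II) with exponent
`B ≥ 2`: for `0 < ν < 1`, `x ≥ 1`, any finsets of faces `S` (strict), `T` (non-strict) in dimension `k`, the kernel
`𝟙[d prime] · 𝟙[u' □-free, Ω(m) = k] μ(u') · ∏_S 𝟙[∑ aᵢ log pᵢ < b log(de)] · ∏_T 𝟙[… ≤ …] · 𝟙[d < (de)^ν] ·
𝟙[primes(m) ≥ (de)^ν] · 𝟙[primes(u') < d] · 𝟙[d u' m > (de)^{1/2}] · 𝟙[x/2 < de ≤ x] w(de)` over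
`d ∈ (1, x^ν]`, `z = (e, (m, u'))` with `e ≤ x`, `m, u' ∣ e`, is bounded by `c_N^{#S + #T + 4} · x/(log x)^B`,
`c_N = 3(1 + log(2⌊x⌋ + 4))` — by the long-side fibre lift and `#S + #T + 4` monotone-threshold separations.
[cite: FordMaynard2024PrimeSieves, proof of Proposition 7.22 (separation of variables and application of (II))] -/
theorem bilin_main_kernel {ν : ℝ} (hν0 : 0 < ν) (hν1 : ν < 1) {x : ℝ} (hx : 1 ≤ x) {w : ℕ → ℝ} {B : ℝ}
    (hB : 2 ≤ B) (hII : Literature.Barriers.Parity.FordMaynard.TypeII w x 0 ν B) (k : ℕ)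
    (S T : Finset ((Fin k → ℝ) × ℝ)) :
    BilinBoundedBy
      (fun (d : ℕ) (z : ℕ × (ℕ × ℕ)) =>
        (if d.Prime then (1 : ℂ) else 0) *
        ((if (Squarefree z.2.2 ∧ z.2.1.primeFactorsList.length = k) then (1 : ℂ) else 0) *
          ((ArithmeticFunction.moebius z.2.2 : ℤ) : ℂ)) *
        ((if ¬ (((d * z.2.2 * z.2.1 : ℕ) : ℝ) ≤ ((d * z.1 : ℕ) : ℝ) ^ (1 / 2 : ℝ)) then (1 : ℂ) else 0) *
        ((if (∀ p ∈ z.2.2.primeFactors, p < d) then (1 : ℂ) else 0) *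
        ((if (∀ p ∈ z.2.1.primeFactors, ((d * z.1 : ℕ) : ℝ) ^ ν ≤ (p : ℝ)) then (1 : ℂ) else 0) *
        ((if ((d : ℝ) < ((d * z.1 : ℕ) : ℝ) ^ ν) then (1 : ℂ) else 0) *
        ((∏ cf ∈ T, if ∑ i, cf.1 i * Real.log (z.2.1.primeFactorsList.getD i 0) ≤
            cf.2 * Real.log ((d * z.1 : ℕ) : ℝ) then (1 : ℂ) else 0) *
        ((∏ cf ∈ S, if ∑ i, cf.1 i * Real.log (z.2.1.primeFactorsList.getD i 0) <
            cf.2 * Real.log ((d * z.1 : ℕ) : ℝ) then (1 : ℂ) else 0) *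
        (if x / 2 < (d * z.1 : ℝ) ∧ (d * z.1 : ℝ) ≤ x then (w (d * z.1) : ℂ) else 0))))))))
      ((Icc 1 ⌊x ^ ((0 : ℝ) + ν)⌋₊).filter (fun m : ℕ => (x / 2) ^ (0 : ℝ) < (m : ℝ)))
      ((Icc 1 ⌊x⌋₊).biUnion (fun e : ℕ => (e.divisors ×ˢ e.divisors).image (fun s : ℕ × ℕ => (e, s))))
      ((3 * (1 + Real.log (2 * (⌊x⌋₊ + 1 : ℕ) + 2))) ^ (S.card + T.card + 4) * (x / Real.log x ^ B)) := by
  classical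
  set N := ⌊x⌋₊ with hN
  set cN : ℝ := 3 * (1 + Real.log (2 * (N + 1 : ℕ) + 2)) with hcN
  set W₀ := (Icc 1 ⌊x ^ ((0 : ℝ) + ν)⌋₊).filter (fun m : ℕ => (x / 2) ^ (0 : ℝ) < (m : ℝ)) with hW₀
  set Z₀ := Icc 1 ⌊x⌋₊ with hZ₀
  -- (II) ⇒ BilinBoundedBy with `τ^2` weights
  have h0 := bilinBoundedBy_of_typeII hII hB
  -- remove the short-side weight
  have h1 : BilinBoundedBy (fun (d e : ℕ) => (((e.divisors.card : ℝ) ^ (2 : ℝ) : ℝ) : ℂ) *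
      (if x / 2 < (d * e : ℝ) ∧ (d * e : ℝ) ≤ x then (w (d * e) : ℂ) else 0)) W₀ Z₀ (x / Real.log x ^ B) := by
    have h := h0.twist (fun d : ℕ => ((((d.divisors.card : ℝ) ^ (2 : ℝ) : ℝ) : ℂ))⁻¹) (fun _ => 1)
      (fun d => by
        rw [norm_inv, Complex.norm_real, Real.norm_of_nonneg (Real.rpow_nonneg (Nat.cast_nonneg _) _)]
        rcases Nat.eq_zero_or_pos d with hd | hd
        · subst hd; simp
        · have h1 : (1 : ℝ) ≤ (d.divisors.card : ℝ) := by
            exact_mod_cast Finset.card_pos.mpr ⟨1, Nat.one_mem_divisors.mpr hd.ne'⟩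
          exact inv_le_one_of_one_le₀ (Real.one_le_rpow h1 (by norm_num)))
      (fun _ => by simp)
    refine h.congr fun d hd e _ => ?_
    have hd1 : 1 ≤ d := (Finset.mem_Icc.mp (Finset.mem_filter.mp hd).1).1
    have hτ : (((d.divisors.card : ℝ) ^ (2 : ℝ) : ℝ) : ℂ) ≠ 0 := by
      have h1 : (1 : ℝ) ≤ (d.divisors.card : ℝ) := by
        exact_mod_cast Finset.card_pos.mpr ⟨1, Nat.one_mem_divisors.mpr (by omega)⟩
      have hpos : (0 : ℝ) < (d.divisors.card : ℝ) := by linarith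
      exact Complex.ofReal_ne_zero.mpr (Real.rpow_pos_of_pos hpos _).ne'
    rw [mul_one, ← mul_assoc, ← mul_assoc, inv_mul_cancel₀ hτ, one_mul]
  -- fibre lift on the long side: `z = (e, (m, u'))`, `#(divisors × divisors) = τ(e)^2`
  have h2 := bilin_fiberLift_long (K := fun (d e : ℕ) =>
      (if x / 2 < (d * e : ℝ) ∧ (d * e : ℝ) ≤ x then (w (d * e) : ℂ) else 0))
    (fun e : ℕ => (e.divisors.card : ℝ) ^ (2 : ℝ)) (fun e _ => Real.rpow_nonneg (Nat.cast_nonneg _) _) h1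
    (fun e : ℕ => e.divisors ×ˢ e.divisors) (fun e _ => by
      rw [Finset.card_product, Nat.cast_mul, Real.rpow_two, sq])
  -- the separations: `W₀ ⊆ [1, N]`
  have hW : W₀ ⊆ Icc 1 N := by
    intro d hd
    rw [hW₀, Finset.mem_filter, Finset.mem_Icc, zero_add] at hd
    rw [Finset.mem_Icc]
    refine ⟨hd.1.1, hd.1.2.trans (Nat.floor_le_floor ?_)⟩
    calc x ^ ν ≤ x ^ (1 : ℝ) := Real.rpow_le_rpow_of_exponent_le hx hν1.le
      _ = x := Real.rpow_one x
  -- faces `S` (strict) and `T` (non-strict): monotone or antitone by the sign of the right-hand side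
  have h3 := bilin_sep_finset S (le_refl 1) hW
    (fun (cf : (Fin k → ℝ) × ℝ) (d : ℕ) (z : ℕ × (ℕ × ℕ)) =>
      ∑ i, cf.1 i * Real.log (z.2.1.primeFactorsList.getD i 0) < cf.2 * Real.log ((d * z.1 : ℕ) : ℝ))
    (fun cf _ => by
      rcases le_total 0 cf.2 with h | h
      · exact Or.inr fun z _ d d' hd hdd' _ hq => lt_mul_log_of_le h z.1 hd hdd' hq
      · exact Or.inl fun z _ d d' hd' hdd' _ hq => lt_mul_log_of_ge h z.1 hd' hdd' hq) h2
  have h4 := bilin_sep_finset T (le_refl 1) hW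
    (fun (cf : (Fin k → ℝ) × ℝ) (d : ℕ) (z : ℕ × (ℕ × ℕ)) =>
      ∑ i, cf.1 i * Real.log (z.2.1.primeFactorsList.getD i 0) ≤ cf.2 * Real.log ((d * z.1 : ℕ) : ℝ))
    (fun cf _ => by
      rcases le_total 0 cf.2 with h | h
      · exact Or.inr fun z _ d d' hd hdd' _ hq => le_mul_log_of_le h z.1 hd hdd' hq
      · exact Or.inl fun z _ d d' hd' hdd' _ hq => le_mul_log_of_ge h z.1 hd' hdd' hq) h3
  -- `d < (d e)^ν` (down-set)
  have h5 := bilin_sep_downset h4 (le_refl 1) hW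
    (fun (d : ℕ) (z : ℕ × (ℕ × ℕ)) => (d : ℝ) < ((d * z.1 : ℕ) : ℝ) ^ ν)
    (fun z _ d d' hd' hdd' _ hq => lt_rpow_mul_of_le hν0.le hν1.le z.1 hd' hdd' hq)
  -- primes of `m` are `≥ (d e)^ν` (down-set)
  have h6 := bilin_sep_downset h5 (le_refl 1) hW
    (fun (d : ℕ) (z : ℕ × (ℕ × ℕ)) => ∀ p ∈ z.2.1.primeFactors, ((d * z.1 : ℕ) : ℝ) ^ ν ≤ (p : ℝ))
    (fun z _ d d' _ hdd' _ hq p hp => rpow_mul_le_of_le hν0.le z.1 hdd' (hq p hp))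
  -- primes of `u'` are `< d` (up-set)
  have h7 := bilin_sep_upset h6 (le_refl 1) hW
    (fun (d : ℕ) (z : ℕ × (ℕ × ℕ)) => ∀ p ∈ z.2.2.primeFactors, p < d)
    (fun z _ d d' _ hdd' _ hq p hp => lt_of_lt_of_le (hq p hp) hdd')
  -- the cutoff `d u' m > (d e)^{1/2}` (up-set)
  have h8 := bilin_sep_upset h7 (le_refl 1) hW
    (fun (d : ℕ) (z : ℕ × (ℕ × ℕ)) => ¬ (((d * z.2.2 * z.2.1 : ℕ) : ℝ) ≤ ((d * z.1 : ℕ) : ℝ) ^ (1 / 2 : ℝ)))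
    (fun z _ d d' hd hdd' _ hq => by
      rw [natCast_le_rpow_half_iff, mul_assoc d z.2.2 z.2.1] at hq
      rw [natCast_le_rpow_half_iff, mul_assoc d' z.2.2 z.2.1]
      exact not_sq_le_of_le _ _ hd hdd' hq)
  -- the one-variable twists: `d` prime; `u'` squarefree, `Ω(m) = k`, `μ(u')`
  have h9 := h8.twist (fun d : ℕ => if d.Prime then (1 : ℂ) else 0)
    (fun z : ℕ × (ℕ × ℕ) => (if (Squarefree z.2.2 ∧ z.2.1.primeFactorsList.length = k) then (1 : ℂ) else 0) *
      ((ArithmeticFunction.moebius z.2.2 : ℤ) : ℂ))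
    (fun d => by split_ifs <;> simp)
    (fun z => by
      rw [norm_mul]
      refine mul_le_one₀ (by split_ifs <;> simp) (norm_nonneg _) ?_
      rw [Complex.norm_intCast]
      exact_mod_cast ArithmeticFunction.abs_moebius_le_one)
  -- collect the constant
  refine h9.mono (le_of_eq ?_)
  simp only [hcN, hN]
  ring


/-- Under the roughness condition of the main case, the rough divisor `m ∣ e` of `n = d e` (`d ≥ 2`) has at most
`1/ν` prime factors: `Ω(m) ≤ ⌊1/ν⌋`. [cite: FordMaynard2024PrimeSieves, proof of Proposition 7.22 ("n₂ has at most 1/σ prime factors")] -/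
theorem length_primeFactorsList_le_floor {ν : ℝ} (hν0 : 0 < ν) {d e m : ℕ} (hd : 2 ≤ d) (he : e ≠ 0)
    (hm : m ∣ e) (hC2 : ∀ p ∈ m.primeFactors, ((d * e : ℕ) : ℝ) ^ ν ≤ (p : ℝ)) :
    m.primeFactorsList.length ≤ ⌊1 / ν⌋₊ := by
  have hm0 : m ≠ 0 := by rintro rfl; exact he (zero_dvd_iff.mp hm)
  have hr : roughPart (((d * e : ℕ) : ℝ) ^ ν) m = m := (smoothPart_eq_one_of_le hm0 hC2).2
  have hmn : m ≤ d * e := (Nat.le_of_dvd (Nat.pos_of_ne_zero he) hm).trans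
    (Nat.le_mul_of_pos_left e (by omega))
  have hn2 : 2 ≤ d * e := le_trans hd (Nat.le_mul_of_pos_right d (Nat.pos_of_ne_zero he))
  have h := length_roughPart_le_of_le ν hn2 hm0 hmn
  rw [hr] at h
  apply Nat.le_floor
  rw [le_div_iff₀ hν0]
  exact h

/-- **The separated kernel IS the main-case summand of one piece** (pointwise, on the index sets): for `d` in the
Type-II range and `z = (e, (m, u'))` with `e ≥ 1`, the product of indicator factors of `bilin_main_kernel` equals
`𝟙[conditions] · w(de) · 𝟙[¬ cut] μ(u') 𝟙[Ω(m) = k] 𝟙[𝐯_k(m; de) ∈ P]` with `P` the piece cut out by the faces `S, T`.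
[cite: FordMaynard2024PrimeSieves, proof of Proposition 7.22 (the separated form of the sum)] -/
theorem main_kernel_eq {ν x : ℝ} {w : ℕ → ℝ} {k : ℕ} {Pset : Set (Fin k → ℝ)}
    {S T : Finset ((Fin k → ℝ) × ℝ)}
    (hST : Pset = {v | (∀ cf ∈ S, ∑ i, cf.1 i * v i < cf.2) ∧ ∀ cf ∈ T, ∑ i, cf.1 i * v i ≤ cf.2})
    {d : ℕ} (hd : 2 ≤ d) {z : ℕ × (ℕ × ℕ)} (hz : 1 ≤ z.1) :
    (if d.Prime then (1 : ℂ) else 0) *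
        ((if (Squarefree z.2.2 ∧ z.2.1.primeFactorsList.length = k) then (1 : ℂ) else 0) *
          ((ArithmeticFunction.moebius z.2.2 : ℤ) : ℂ)) *
        ((if ¬ (((d * z.2.2 * z.2.1 : ℕ) : ℝ) ≤ ((d * z.1 : ℕ) : ℝ) ^ (1 / 2 : ℝ)) then (1 : ℂ) else 0) *
        ((if (∀ p ∈ z.2.2.primeFactors, p < d) then (1 : ℂ) else 0) *
        ((if (∀ p ∈ z.2.1.primeFactors, ((d * z.1 : ℕ) : ℝ) ^ ν ≤ (p : ℝ)) then (1 : ℂ) else 0) *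
        ((if ((d : ℝ) < ((d * z.1 : ℕ) : ℝ) ^ ν) then (1 : ℂ) else 0) *
        ((∏ cf ∈ T, if ∑ i, cf.1 i * Real.log (z.2.1.primeFactorsList.getD i 0) ≤
            cf.2 * Real.log ((d * z.1 : ℕ) : ℝ) then (1 : ℂ) else 0) *
        ((∏ cf ∈ S, if ∑ i, cf.1 i * Real.log (z.2.1.primeFactorsList.getD i 0) <
            cf.2 * Real.log ((d * z.1 : ℕ) : ℝ) then (1 : ℂ) else 0) *
        (if x / 2 < (d * z.1 : ℝ) ∧ (d * z.1 : ℝ) ≤ x then (w (d * z.1) : ℂ) else 0))))))) =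
      ((if (d.Prime ∧ (d : ℝ) < ((d * z.1 : ℕ) : ℝ) ^ ν ∧
              (∀ p ∈ z.2.1.primeFactors, ((d * z.1 : ℕ) : ℝ) ^ ν ≤ (p : ℝ)) ∧
              (∀ p ∈ z.2.2.primeFactors, p < d) ∧ Squarefree z.2.2 ∧
              (x / 2 < (d * z.1 : ℝ) ∧ (d * z.1 : ℝ) ≤ x)) then
            w (d * z.1) *
              (if ((d * z.2.2 * z.2.1 : ℕ) : ℝ) ≤ ((d * z.1 : ℕ) : ℝ) ^ (1 / 2 : ℝ) then 0
                else ((ArithmeticFunction.moebius z.2.2 : ℤ) : ℝ) *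
                  (if z.2.1.primeFactorsList.length = k then
                    (if (fun i : Fin k => Real.log (z.2.1.primeFactorsList.getD i 0) /
                        Real.log ((d * z.1 : ℕ) : ℝ)) ∈ Pset then (1 : ℝ) else 0)
                  else 0))
          else 0 : ℝ) : ℂ) := by
  by_cases hcond : (d.Prime ∧ (d : ℝ) < ((d * z.1 : ℕ) : ℝ) ^ ν ∧
      (∀ p ∈ z.2.1.primeFactors, ((d * z.1 : ℕ) : ℝ) ^ ν ≤ (p : ℝ)) ∧
      (∀ p ∈ z.2.2.primeFactors, p < d) ∧ Squarefree z.2.2 ∧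
      (x / 2 < (d * z.1 : ℝ) ∧ (d * z.1 : ℝ) ≤ x))
  · obtain ⟨hp, hC1, hC2, hC3, hsq, hwin⟩ := hcond
    rw [if_pos (show _ ∧ _ ∧ _ ∧ _ ∧ _ ∧ _ from ⟨hp, hC1, hC2, hC3, hsq, hwin⟩)]
    simp only [if_pos hp, if_pos hC1, if_pos hC2, if_pos hC3, if_pos hwin, one_mul]
    by_cases hcut : ((d * z.2.2 * z.2.1 : ℕ) : ℝ) ≤ ((d * z.1 : ℕ) : ℝ) ^ (1 / 2 : ℝ)
    · rw [if_pos hcut, if_neg (not_not_intro hcut)]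
      push_cast
      ring
    · rw [if_neg hcut, if_pos hcut]
      by_cases hKk : z.2.1.primeFactorsList.length = k
      · rw [if_pos ⟨hsq, hKk⟩, if_pos hKk]
        have hL : 0 < Real.log ((d * z.1 : ℕ) : ℝ) := by
          apply Real.log_pos
          have : 2 ≤ d * z.1 := le_trans hd (Nat.le_mul_of_pos_right d hz)
          exact_mod_cast lt_of_lt_of_le (by norm_num : (1 : ℕ) < 2) this
        have hface := indicator_mem_pieces_eq_prod hST
          (fun i : Fin k => Real.log (z.2.1.primeFactorsList.getD i 0)) hL
        rw [Complex.ofReal_mul, Complex.ofReal_mul, apply_ite ((↑) : ℝ → ℂ), Complex.ofReal_one,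
          Complex.ofReal_zero, hface]
        push_cast
        ring
      · rw [if_neg (fun h => hKk h.2), if_neg hKk]
        push_cast
        ring
  · rw [if_neg hcond, Complex.ofReal_zero]
    rcases not_and_or.mp hcond with h | hcond
    · rw [if_neg h]; ring
    rcases not_and_or.mp hcond with h | hcond
    · rw [if_neg h]; ring
    rcases not_and_or.mp hcond with h | hcond
    · rw [if_neg h]; ring
    rcases not_and_or.mp hcond with h | hcond
    · rw [if_neg h]; ring
    rcases not_and_or.mp hcond with h | hcond
    · rw [if_neg (show ¬ (Squarefree z.2.2 ∧ z.2.1.primeFactorsList.length = k) from fun h' => h h'.1)]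
      ring
    · rw [if_neg hcond]; ring

end Summit.Parity.GeneralizedHardyLittlewood.FordMaynardSieveConst01651SieveConst01651
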